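/-
Copyright (c) 2026 the pub-hodgecm-mathlib formalisation cell (harness21).  Prover seat hodgecm-mathlib-K2E1-p14 (g3), Track B ∕ K2-LIT, h413 = `stmt-HodgeConjecture-24833`,
R90-TF section S8 «ContSpec-n½», socket #2 ∕ (E) road at N = 3 (S8 dealer R90-CS-plan (g2) S8-R91 (i) + collision ruling S8-R93: §1 of the deal is K2E1-p11's ★
`R90S8ProjectionCommutesSupClosure`): the K-TYPE GLUE — a LEVEL letter `T ≤ closure ⨆_b Blk_b` becomes its K-type twin `T ⊓ Iso_τ ≤ closure ⨆_b (Blk_b ⊓ Iso_τ)` for every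
`K_∞`-type `τ`, because the isotypic projector preserves every closed `K_∞`-stable block (★ `starProjection_isotypicComponent_mem'`); instantiated at the ★ K-type blocks of record
`resGBlockK` (K2E1-p11 ★ p862819) on Mok's `U(J₃)`; and the (D₃) letter (★ p862817) re-associated to ★ F1_qs's `P ⊓ Iso i` bytes.
-/
import Summits.HodgeConjecture.HodgeConjecture.Theorems.R90S8ProjectionCommutesSupClosure   -- ★ (K2E1-p11): `inf_le_topologicalClosure_iSup_inf_of_le` (orthogonal projection preserving every `S_b`)
import Summits.HodgeConjecture.HodgeConjecture.Theorems.R90S8ResGKTypeBlockU3Defs            -- ★ p862819 (K2E1-p11): `resGBlockK Iso Kf χ₁ χ₂ := resGBlock (Kf.map ι_f) 1 χ₁ χ₂ ⊓ Iso`; brings ★ `resGBlock`, `isClosed_resGBlock`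
import Summits.HodgeConjecture.HodgeConjecture.Theorems.R90S8ResGIsotypicDensityU3           -- ★ p862817 (this seat): (D₃) `residualG_isotypic_density_kType_three(_maximalLevel)`, `compactSpace_arch_inf_unitaryOne`
import Summits.HodgeConjecture.HodgeConjecture.Theorems.R90S8ResGLeClosureOfLettersU3           -- ★ F1_qs p862541 (R90-C133-p03): the consumer `residualG_le_topologicalClosure_of_letters_quasiSplit`; brings `cuspidalSubspace`, `residualSubspace`
import Literature.NumberTheory.Automorphic.HilbertRepIsotypicComponent                      -- ★ `ContRepresentation.starProjection_isotypicComponent_mem'`, `ClosedSubrep.instCompleteSpace`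
import HarnessLib

/-!
# S8 #2 ∕ (E) road at N = 3 — `R90S8KTypeProjectionGlueU3`: THE K-TYPE GLUE — every LEVEL letter `T ≤ cl ⨆_b Blk_b` over closed `K_∞`-stable blocks yields its K-TYPE twin
# `T ⊓ Iso_τ ≤ cl ⨆_b (Blk_b ⊓ Iso_τ)` (`Iso_τ` = a `K_∞`-isotypic component of `L²`); at the ★ blocks of record `resGBlockK`; and (D₃) in ★ F1_qs's `P ⊓ Iso i` association

Track B ∕ K2-LIT, crux h413 = `stmt-HodgeConjecture-24833`, route of record `HCCMUnconditional`; cell `hodgecm-mathlib`, R90-TF programme, section S8 «ContSpec-n½», socket #2's ED. 5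
sub-socket (E) `sock_S8_res_exhaustion_le_closure` (S8-R68) and its letter road (HEAD₃)(E_blk,₃)(O₃)(N₃) at K-TYPE blocks (currency ruling S8-R82 (2), refined S8-R87: the K-type cut lives on
the `L²` side, `Iso` a parameter).  THEOREMS ONLY (no `def`, no `instance`, no `notation`, no named-fact hypothesis, no `sorry`; default heartbeats); lane
`--supports stmt-HodgeConjecture-24833 --as helper` (count-neutral).  CLOSES NO SOCKET: glue — it turns LEVEL letters into K-type letters; the blocks' `K_∞`-stability stays a VISIBLE letter.

THE MATHEMATICS ([DeitmarEchterhoff2014, §7.3, Prop. 7.3.3]; [BrockerTomDieck1985, III Thm. (5.10)]; [Dixmier1977, §5.4]; [MoeglinWaldspurger1995, II.2.4]).  Let `ρ` be a UNITARY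
representation of a group `K` on a Hilbert space `H`, `τ` any representation of `K`, `N_τ := ρ.isotypicComponent τ` (closed, `ρ`-stable), `P_τ` the orthogonal projection onto `N_τ`.
★ `starProjection_isotypicComponent_mem'`: `P_τ` maps every CLOSED `ρ`-STABLE subspace `S` into itself (the isotypic projections are central in the commutant: `P_S` commutes with `ρ`, hence
preserves `N_τ` and `N_τᗮ`).  Hence for a family of closed `ρ`-stable blocks `S_b`, ★ K2E1-p11's `inf_le_topologicalClosure_iSup_inf_of_le` gives: `T ≤ cl ⨆_b S_b ⟹ T ⊓ N_τ ≤ cl ⨆_b (S_b ⊓ N_τ)`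
(§1, `τ` and `T` arbitrary; NO compactness or continuity needed — pure unitarity).  §2 reads it on Mok's `U(J₃) = quasiSplit L⁺ L c 3` with `K := K_∞ = U(J₃)(L⁺⊗ℝ) ∩ U(1⊗1)`,
`ρ := R ∘ ι_∞ ∘ (Subgroup.inclusion inf_le_left)` (κ OF RECORD, N = 3) and the ★ finite-level blocks `S_b := resGBlock L μ (Kf.map ι_f) 1 (χ₁ b) (χ₂ b)` (closed ★ `isClosed_resGBlock`;
`K_∞`-STABILITY = the visible letter `hstab`, payable from the right-`K_∞`-invariance of `H` and the commuting of `ι_∞` with `ι_f`): the conclusion's summands ARE ★ `resGBlockK L μ N_τ Kf (χ₁ b) (χ₂ b)`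
(`rfl`).  §3 is the consumer shape of ★ F1_qs `residualG_le_topologicalClosure_of_letters_quasiSplit`'s `hHead i` at the K-type index of record `i = (Kf, U)`,
`Iso i := Fix(ι_f Kf) ⊓ N_{U}`: from the LEVEL exhaustion letter `(L²_cusp)ᗮ ⊓ Fix(ι_f Kf) ≤ cl ⨆_b resGBlock (Kf.map ι_f) 1 b` (+ `hstab`) to `(L²_cusp)ᗮ ⊓ Iso i ≤ cl ⨆_b resGBlockK N_U Kf b`.
§4 re-associates ★ (D₃) `residualG_isotypic_density_kType_three(_maximalLevel)` (`(P ⊓ Fix) ⊓ N_U`) into F1_qs's `P ⊓ Iso i` bytes (`P ⊓ (Fix ⊓ N_U)`).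
* §1 **`inf_isotypicComponent_le_topologicalClosure_iSup_inf_of_le`** (abstract: unitary `ρ`, any `τ`, closed `ρ`-stable blocks), `inf_inf_isotypicComponent_le_topologicalClosure_iSup_inf_of_le` (left side pre-cut `R ⊓ T`).
* §2 **`inf_isotypicComponent_le_topologicalClosure_iSup_resGBlockK`** (U(J₃), κ OF RECORD, visible `hstab`).
* §3 **`hHead_kType_of_level_three`** (F1_qs `hHead i` at `Iso i = Fix(ι_f Kf) ⊓ N_U` from the level letter).
* §4 **`residualG_isotypic_density_kType_three_assoc`**, `…_maximalLevel_assoc` ((D₃) in the `P ⊓ Iso i` association).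
HONEST LABEL: HC_CM is proved only modulo the 7 printed citations (2 remaining named inputs: hLiu418 = `stmt-HodgeConjecture-24832`, h413 = `stmt-HodgeConjecture-24833`) until
rung 0 closes; REL ≠ ★ ≠ BUILT; this file asserts no named fact and closes no socket (glue; (HEAD₃) at the level and the blocks' `K_∞`-stability stay letters); count-neutral.

## References
* [DeitmarEchterhoff2014] A. Deitmar, S. Echterhoff, *Principles of Harmonic Analysis* (2nd ed., 2014), §7.3, Prop. 7.3.3.
* [BrockerTomDieck1985] T. Bröcker, T. tom Dieck, *Representations of Compact Lie Groups*, GTM 98 (1985), III Thm. (5.10).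
* [Dixmier1977] J. Dixmier, *C\*-Algebras* (1977), §5.4, §13.1.
* [MoeglinWaldspurger1995] C. Mœglin, J.-L. Waldspurger, *Spectral Decomposition and Eisenstein Series* (1995), I.2.17–18, II.2.4.
-/

set_option autoImplicit false
set_option linter.dupNamespace false  -- the mandated namespace `…HodgeConjecture.HodgeConjecture.R90.S8` (LEAD #1 L1) repeats the summit's segment

noncomputable section

open MeasureTheory Measure Set Filter Topology NumberField NumberField.mixedEmbedding IsDedekindDomain
open Literature.NumberTheory.Automorphic Literature.NumberTheory.Automorphic.UnitaryGroup Literature.NumberTheory.GaloisRepresentations AdelicGroupData ContRepresentation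
open Literature.NumberTheory.Automorphic.Arthur2013.Leaves.TECR
open Summit.HodgeConjecture.HodgeConjecture.Cruxes.H413.K2E1CuspidalSpectrumUnitary (residualSubspace)
open scoped ENNReal NNReal

namespace Summit.HodgeConjecture.HodgeConjecture.R90.S8

/-! ## §1 Abstract: a LEVEL letter cut by an isotypic component -/

section Abstract

variable {C : Type*} [Group C] {H H' : Type*} [NormedAddCommGroup H] [InnerProductSpace ℂ H] [CompleteSpace H]
  [NormedAddCommGroup H'] [InnerProductSpace ℂ H']

/-- **THE K-TYPE TWIN OF A LEVEL LETTER**: for a UNITARY representation `ρ` of a group `C` on the Hilbert space `H`, ANY representation `τ`, a family `S_b` of CLOSED `ρ`-STABLE subspaces and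
`T ≤ cl ⨆_b S_b`: `T ⊓ N_τ ≤ cl ⨆_b (S_b ⊓ N_τ)`, `N_τ = ρ.isotypicComponent τ` — K2E1-p11's ★ `inf_le_topologicalClosure_iSup_inf_of_le` at `K := N_τ`, whose hypothesis «`P_{N_τ}` preserves every
`S_b`» is ★ `starProjection_isotypicComponent_mem'` (the isotypic projection preserves closed invariant subspaces).  No compactness, no continuity. [cite: DeitmarEchterhoff2014, Prop. 7.3.3] [cite: Dixmier1977, §5.4] -/
theorem inf_isotypicComponent_le_topologicalClosure_iSup_inf_of_le {ρ : ContRepresentation ℂ C H} (hρ : ρ.IsUnitary) (τ : ContRepresentation ℂ C H')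
    {ι : Sort*} (S : ι → Submodule ℂ H) (hSc : ∀ b, IsClosed (S b : Set H)) (hSinv : ∀ (b) (c : C), ∀ v ∈ S b, ρ c v ∈ S b)
    (T : Submodule ℂ H) (hT : T ≤ (⨆ b, S b).topologicalClosure) :
    T ⊓ (ρ.isotypicComponent τ).toSubmodule ≤ (⨆ b, S b ⊓ (ρ.isotypicComponent τ).toSubmodule).topologicalClosure :=
  inf_le_topologicalClosure_iSup_inf_of_le (ρ.isotypicComponent τ).toSubmodule S
    (fun b _ hv => ContRepresentation.starProjection_isotypicComponent_mem' (σ := τ) hρ (hSc b) (hSinv b) hv) T hT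

/-- **The same with the left side pre-cut**: `R ⊓ T ≤ cl ⨆_b S_b ⟹ R ⊓ (T ⊓ N_τ) ≤ cl ⨆_b (S_b ⊓ N_τ)` (the shape `(L²_cusp)ᗮ ⊓ (Fix ⊓ N_τ)` of a print's `Iso i = Fix ⊓ N_τ`). [cite: DeitmarEchterhoff2014, Prop. 7.3.3] -/
theorem inf_inf_isotypicComponent_le_topologicalClosure_iSup_inf_of_le {ρ : ContRepresentation ℂ C H} (hρ : ρ.IsUnitary) (τ : ContRepresentation ℂ C H')
    {ι : Sort*} (S : ι → Submodule ℂ H) (hSc : ∀ b, IsClosed (S b : Set H)) (hSinv : ∀ (b) (c : C), ∀ v ∈ S b, ρ c v ∈ S b)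
    (R T : Submodule ℂ H) (hT : R ⊓ T ≤ (⨆ b, S b).topologicalClosure) :
    R ⊓ (T ⊓ (ρ.isotypicComponent τ).toSubmodule) ≤ (⨆ b, S b ⊓ (ρ.isotypicComponent τ).toSubmodule).topologicalClosure := by
  rw [← inf_assoc]
  exact inf_isotypicComponent_le_topologicalClosure_iSup_inf_of_le hρ τ S hSc hSinv (R ⊓ T) hT

end Abstract

/-! ## §2–§4 Mok's `U(J₃) = quasiSplit L⁺ L c 3`, `K_∞ = U(J₃)(L⁺⊗ℝ) ∩ U(1⊗1)` through the κ OF RECORD, the ★ blocks of record -/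

section CMThree

variable (L : Type) [Field L] [NumberField L] [IsCMField L]
  (μ : Measure (quasiSplit (↥(maximalRealSubfield L)) L (IsCMField.complexConj L) 3).automorphicQuotient) [(quasiSplit (↥(maximalRealSubfield L)) L (IsCMField.complexConj L) 3).IsAutomorphicMeasure μ]

/-- **LEVEL ⟹ K-TYPE AT THE BLOCKS OF RECORD**: for a finite level `Kf`, a block index `β` with data `(χ₁ b, χ₂ b)`, a `K_∞`-type `τ` and the VISIBLE letter `hstab` («every finite-level block
`resGBlock L μ (Kf.map ι_f) 1 (χ₁ b) (χ₂ b)` is `K_∞`-stable under `ρ = R ∘ ι_∞|_{K_∞}`»): `T ≤ cl ⨆_b resGBlock … b ⟹ T ⊓ N_τ ≤ cl ⨆_b resGBlockK L μ N_τ Kf (χ₁ b) (χ₂ b)` (★ `resGBlockK = resGBlock ⊓ Iso`,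
`rfl`; blocks closed ★ `isClosed_resGBlock`; `R` unitary ★ `isUnitary_rightRegular`). [cite: DeitmarEchterhoff2014, Prop. 7.3.3] [cite: MoeglinWaldspurger1995, II.2.4] -/
theorem inf_isotypicComponent_le_topologicalClosure_iSup_resGBlockK
    (Kf : Subgroup ↥(finAdelic (↥(maximalRealSubfield L)) L (IsCMField.complexConj L) 3 ((StdForm.antidiagonal 3).over L))) {β : Type*} (χ₁ : β → HeckeCharacter L) (χ₂ : β → (↥(TorusDict.torus (IsCMField.complexConj L)) →ₜ* ℂˣ))
    (hstab : ∀ (b : β) (k : ↥(UnitaryGroup.arch (↥(maximalRealSubfield L)) L (IsCMField.complexConj L) 3 ((StdForm.antidiagonal 3).over L) ⊓ unitaryGroupOfForm (conjMixed (↥(maximalRealSubfield L)) L (IsCMField.complexConj L)) 1)), ∀ v ∈ resGBlock L μ (Kf.map (finAdelicToAdelic (↥(maximalRealSubfield L)) L (IsCMField.complexConj L) 3 ((StdForm.antidiagonal 3).over L))) 1 (χ₁ b) (χ₂ b), ((((quasiSplit (↥(maximalRealSubfield L)) L (IsCMField.complexConj L) 3).rightRegular μ).restrict ((archToAdelic (↥(maximalRealSubfield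 L)) L (IsCMField.complexConj L) 3 ((StdForm.antidiagonal 3).over L)).comp (Subgroup.inclusion (inf_le_left : (UnitaryGroup.arch (↥(maximalRealSubfield L)) L (IsCMField.complexConj L) 3 ((StdForm.antidiagonal 3).over L) ⊓ unitaryGroupOfForm (conjMixed (↥(maximalRealSubfield L)) L (IsCMField.complexConj L)) 1) ≤ UnitaryGroup.arch (↥(maximalRealSubfield L)) L (IsCMField.complexConj L) 3 ((StdForm.antidiagonal 3).over L)))))) k v ∈ resGBlock L μ (Kf.map (finAdelicToAdelic (↥(maximalRealSubfield L)) L (IsCMField.complexConj L) 3 ((StdForm.antidiagonal 3).over L))) 1 (χ₁ b) (χ₂ b))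
    {H' : Type*} [NormedAddCommGroup H'] [InnerProductSpace ℂ H'] (τ : ContRepresentation ℂ ↥(UnitaryGroup.arch (↥(maximalRealSubfield L)) L (IsCMField.complexConj L) 3 ((StdForm.antidiagonal 3).over L) ⊓ unitaryGroupOfForm (conjMixed (↥(maximalRealSubfield L)) L (IsCMField.complexConj L)) 1) H')
    (T : Submodule ℂ ((quasiSplit (↥(maximalRealSubfield L)) L (IsCMField.complexConj L) 3).L2 μ)) (hT : T ≤ (⨆ b, resGBlock L μ (Kf.map (finAdelicToAdelic (↥(maximalRealSubfield L)) L (IsCMField.complexConj L) 3 ((StdForm.antidiagonal 3).over L))) 1 (χ₁ b) (χ₂ b)).topologicalClosure) :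
    T ⊓ (((((quasiSplit (↥(maximalRealSubfield L)) L (IsCMField.complexConj L) 3).rightRegular μ).restrict ((archToAdelic (↥(maximalRealSubfield L)) L (IsCMField.complexConj L) 3 ((StdForm.antidiagonal 3).over L)).comp (Subgroup.inclusion (inf_le_left : (UnitaryGroup.arch (↥(maximalRealSubfield L)) L (IsCMField.complexConj L) 3 ((StdForm.antidiagonal 3).over L) ⊓ unitaryGroupOfForm (conjMixed (↥(maximalRealSubfield L)) L (IsCMField.complexConj L)) 1) ≤ UnitaryGroup.arch (↥(maximalRealSubfield L)) L (IsCMField.complexConj L) 3 ((StdForm.antidiagonal 3).over L)))))).isotypicComponent τ).toSubmodule ≤ (⨆ b, resGBlockK L μ (((((quasiSplit (↥(maximalRealSubfield L)) L (IsCMField.complexConj L) 3).rightRegular μ).restrict ((archToAdelic (↥(maximalRealSubfield L)) L (IsCMField.complexConj L) 3 ((StdForm.antidiagonal 3).over L)).comp (Subgroup.inclusion (inf_le_left : (UnitaryGroup.arch (↥(maximalRealSubfield L)) L (IsCMField.complexConj L) 3 ((StdForm.antidiagonal 3).over L) ⊓ unitaryGroupOfForm (conjMixed (↥(maximalRealSubfield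 L)) L (IsCMField.complexConj L)) 1) ≤ UnitaryGroup.arch (↥(maximalRealSubfield L)) L (IsCMField.complexConj L) 3 ((StdForm.antidiagonal 3).over L)))))).isotypicComponent τ).toSubmodule Kf (χ₁ b) (χ₂ b)).topologicalClosure :=
  inf_isotypicComponent_le_topologicalClosure_iSup_inf_of_le (ρ := (((quasiSplit (↥(maximalRealSubfield L)) L (IsCMField.complexConj L) 3).rightRegular μ).restrict ((archToAdelic (↥(maximalRealSubfield L)) L (IsCMField.complexConj L) 3 ((StdForm.antidiagonal 3).over L)).comp (Subgroup.inclusion (inf_le_left : (UnitaryGroup.arch (↥(maximalRealSubfield L)) L (IsCMField.complexConj L) 3 ((StdForm.antidiagonal 3).over L) ⊓ unitaryGroupOfForm (conjMixed (↥(maximalRealSubfield L)) L (IsCMField.complexConj L)) 1) ≤ UnitaryGroup.arch (↥(maximalRealSubfield L)) L (IsCMField.complexConj L) 3 ((StdForm.antidiagonal 3).over L)))))) (fun _ => ((quasiSplit (↥(maximalRealSubfield L)) L (IsCMField.complexConj L) 3).isUnitary_rightRegular μ) _) τ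
    (fun b => resGBlock L μ (Kf.map (finAdelicToAdelic (↥(maximalRealSubfield L)) L (IsCMField.complexConj L) 3 ((StdForm.antidiagonal 3).over L))) 1 (χ₁ b) (χ₂ b)) (fun b => isClosed_resGBlock L μ _ 1 (χ₁ b) (χ₂ b)) hstab T hT

/-- **F1_qs's `hHead i` AT THE K-TYPE INDEX OF RECORD FROM THE LEVEL LETTER**: at `i = (Kf, U)`, `Iso i := Fix(ι_f Kf) ⊓ N_U` (★ (D₃)'s pieces; `N_U = ρ.isotypicComponent U.toContRep`), the LEVEL
exhaustion letter `hHead_level : (L²_cusp(𝔓))ᗮ ⊓ Fix(ι_f Kf) ≤ cl ⨆_b resGBlock L μ (Kf.map ι_f) 1 (χ₁ b) (χ₂ b)` and the stability letter `hstab` give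
`(L²_cusp(𝔓))ᗮ ⊓ (Fix(ι_f Kf) ⊓ N_U) ≤ cl ⨆_b resGBlockK L μ N_U Kf (χ₁ b) (χ₂ b)` — the `hHead i` binder of ★ `residualG_le_topologicalClosure_of_letters_quasiSplit` with `Blk i b := resGBlockK L μ N_U Kf (χ₁ b) (χ₂ b)`.
[cite: MoeglinWaldspurger1995, II.2.4] [cite: DeitmarEchterhoff2014, Prop. 7.3.3] -/
theorem hHead_kType_of_level_three (𝔓 : (quasiSplit (↥(maximalRealSubfield L)) L (IsCMField.complexConj L) 3).ParabolicUnipotentData)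
    (Kf : Subgroup ↥(finAdelic (↥(maximalRealSubfield L)) L (IsCMField.complexConj L) 3 ((StdForm.antidiagonal 3).over L))) {β : Type*} (χ₁ : β → HeckeCharacter L) (χ₂ : β → (↥(TorusDict.torus (IsCMField.complexConj L)) →ₜ* ℂˣ))
    (hstab : ∀ (b : β) (k : ↥(UnitaryGroup.arch (↥(maximalRealSubfield L)) L (IsCMField.complexConj L) 3 ((StdForm.antidiagonal 3).over L) ⊓ unitaryGroupOfForm (conjMixed (↥(maximalRealSubfield L)) L (IsCMField.complexConj L)) 1)), ∀ v ∈ resGBlock L μ (Kf.map (finAdelicToAdelic (↥(maximalRealSubfield L)) L (IsCMField.complexConj L) 3 ((StdForm.antidiagonal 3).over L))) 1 (χ₁ b) (χ₂ b), ((((quasiSplit (↥(maximalRealSubfield L)) L (IsCMField.complexConj L) 3).rightRegular μ).restrict ((archToAdelic (↥(maximalRealSubfield L)) L (IsCMField.complexConj L) 3 ((StdForm.antidiagonal 3).over L)).comp (Subgroup.inclusion (inf_le_left : (UnitaryGroup.arch (↥(maximalRealSubfield L)) L (IsCMField.complexConj L) 3 ((StdForm.antidiagonal 3).over L) ⊓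 unitaryGroupOfForm (conjMixed (↥(maximalRealSubfield L)) L (IsCMField.complexConj L)) 1) ≤ UnitaryGroup.arch (↥(maximalRealSubfield L)) L (IsCMField.complexConj L) 3 ((StdForm.antidiagonal 3).over L)))))) k v ∈ resGBlock L μ (Kf.map (finAdelicToAdelic (↥(maximalRealSubfield L)) L (IsCMField.complexConj L) 3 ((StdForm.antidiagonal 3).over L))) 1 (χ₁ b) (χ₂ b))
    (U : ClosedSubrep (((quasiSplit (↥(maximalRealSubfield L)) L (IsCMField.complexConj L) 3).rightRegular μ).restrict ((archToAdelic (↥(maximalRealSubfield L)) L (IsCMField.complexConj L) 3 ((StdForm.antidiagonal 3).over L)).comp (Subgroup.inclusion (inf_le_left : (UnitaryGroup.arch (↥(maximalRealSubfield L)) L (IsCMField.complexConj L) 3 ((StdForm.antidiagonal 3).over L) ⊓ unitaryGroupOfForm (conjMixed (↥(maximalRealSubfield L)) L (IsCMField.complexConj L)) 1) ≤ UnitaryGroup.arch (↥(maximalRealSubfield L)) L (IsCMField.complexConj L) 3 ((StdForm.antidiagonal 3).over L))))))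
    (hHead_level : ((quasiSplit (↥(maximalRealSubfield L)) L (IsCMField.complexConj L) 3).cuspidalSubspace μ 𝔓).toSubmoduleᗮ ⊓ (⨅ u : ↥(Kf), Module.End.eigenspace ((((quasiSplit (↥(maximalRealSubfield L)) L (IsCMField.complexConj L) 3).rightRegular μ) (finAdelicToAdelic (↥(maximalRealSubfield L)) L (IsCMField.complexConj L) 3 ((StdForm.antidiagonal 3).over L) (u : ↥(finAdelic (↥(maximalRealSubfield L)) L (IsCMField.complexConj L) 3 ((StdForm.antidiagonal 3).over L)))) :
        (quasiSplit (↥(maximalRealSubfield L)) L (IsCMField.complexConj L) 3).L2 μ →L[ℂ] (quasiSplit (↥(maximalRealSubfield L)) L (IsCMField.complexConj L) 3).L2 μ) : (quasiSplit (↥(maximalRealSubfield L)) L (IsCMField.complexConj L) 3).L2 μ →ₗ[ℂ] (quasiSplit (↥(maximalRealSubfield L)) L (IsCMField.complexConj L) 3).L2 μ) 1) ≤ (⨆ b, resGBlock L μ (Kf.map (finAdelicToAdelic (↥(maximalRealSubfield L)) L (IsCMField.complexConj L) 3 ((StdForm.antidiagonal 3).over L))) 1 (χ₁ b) (χ₂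 b)).topologicalClosure) :
    ((quasiSplit (↥(maximalRealSubfield L)) L (IsCMField.complexConj L) 3).cuspidalSubspace μ 𝔓).toSubmoduleᗮ ⊓ ((⨅ u : ↥(Kf), Module.End.eigenspace ((((quasiSplit (↥(maximalRealSubfield L)) L (IsCMField.complexConj L) 3).rightRegular μ) (finAdelicToAdelic (↥(maximalRealSubfield L)) L (IsCMField.complexConj L) 3 ((StdForm.antidiagonal 3).over L) (u : ↥(finAdelic (↥(maximalRealSubfield L)) L (IsCMField.complexConj L) 3 ((StdForm.antidiagonal 3).over L)))) :
        (quasiSplit (↥(maximalRealSubfield L)) L (IsCMField.complexConj L) 3).L2 μ →L[ℂ] (quasiSplit (↥(maximalRealSubfield L)) L (IsCMField.complexConj L) 3).L2 μ) : (quasiSplit (↥(maximalRealSubfield L)) L (IsCMField.complexConj L) 3).L2 μ →ₗ[ℂ] (quasiSplit (↥(maximalRealSubfield L)) L (IsCMField.complexConj L) 3).L2 μ) 1) ⊓ (((((quasiSplit (↥(maximalRealSubfield L)) L (IsCMField.complexConj L) 3).rightRegular μ).restrict ((archToAdelic (↥(maximalRealSubfield L)) L (IsCMField.complexConj L) 3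 ((StdForm.antidiagonal 3).over L)).comp (Subgroup.inclusion (inf_le_left : (UnitaryGroup.arch (↥(maximalRealSubfield L)) L (IsCMField.complexConj L) 3 ((StdForm.antidiagonal 3).over L) ⊓ unitaryGroupOfForm (conjMixed (↥(maximalRealSubfield L)) L (IsCMField.complexConj L)) 1) ≤ UnitaryGroup.arch (↥(maximalRealSubfield L)) L (IsCMField.complexConj L) 3 ((StdForm.antidiagonal 3).over L)))))).isotypicComponent U.toContRep).toSubmodule) ≤
      (⨆ b, resGBlockK L μ (((((quasiSplit (↥(maximalRealSubfield L)) L (IsCMField.complexConj L) 3).rightRegular μ).restrict ((archToAdelic (↥(maximalRealSubfield L)) L (IsCMField.complexConj L) 3 ((StdForm.antidiagonal 3).over L)).comp (Subgroup.inclusion (inf_le_left : (UnitaryGroup.arch (↥(maximalRealSubfield L)) L (IsCMField.complexConj L) 3 ((StdForm.antidiagonal 3).over L) ⊓ unitaryGroupOfForm (conjMixed (↥(maximalRealSubfield L)) L (IsCMField.complexConj L)) 1) ≤ UnitaryGroup.arch (↥(maximalRealSubfield L)) L (IsCMField.complexConj L) 3 ((StdForm.antidiagonal 3).over L)))))).isotypicComponent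 U.toContRep).toSubmodule Kf (χ₁ b) (χ₂ b)).topologicalClosure := by
  rw [← inf_assoc]
  exact inf_isotypicComponent_le_topologicalClosure_iSup_resGBlockK L μ Kf χ₁ χ₂ hstab U.toContRep _ hHead_level

/-- **(D₃) IN F1_qs's `P ⊓ Iso i` ASSOCIATION**: ★ `residualG_isotypic_density_kType_three` with its pieces `(P ⊓ Fix) ⊓ N_U` re-associated to `P ⊓ (Fix ⊓ N_U) = P ⊓ Iso i` — the `hD` binder of ★
`residualG_le_topologicalClosure_of_letters_quasiSplit` at `Iso := fun i => Fix(ι_f i.1.1) ⊓ N_{i.2.1}`, any open `K₀`. [cite: BrockerTomDieck1985, III (5.7), Thm. (5.10)] [cite: BorelJacquet1979, §4.1] -/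
theorem residualG_isotypic_density_kType_three_assoc (P : ClosedSubrep ((quasiSplit (↥(maximalRealSubfield L)) L (IsCMField.complexConj L) 3).rightRegular μ)) (hP : P.toContRep.IsTopIrreducible)
    (K₀ : Subgroup ↥(finAdelic (↥(maximalRealSubfield L)) L (IsCMField.complexConj L) 3 ((StdForm.antidiagonal 3).over L))) (hK₀ : IsOpen ((K₀ : Subgroup ↥(finAdelic (↥(maximalRealSubfield L)) L (IsCMField.complexConj L) 3 ((StdForm.antidiagonal 3).over L))) : Set ↥(finAdelic (↥(maximalRealSubfield L)) L (IsCMField.complexConj L) 3 ((StdForm.antidiagonal 3).over L)))) :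
    P.toSubmodule ≤ (⨆ i : {Kf : Subgroup ↥(finAdelic (↥(maximalRealSubfield L)) L (IsCMField.complexConj L) 3 ((StdForm.antidiagonal 3).over L)) // IsOpen ((Kf : Subgroup ↥(finAdelic (↥(maximalRealSubfield L)) L (IsCMField.complexConj L) 3 ((StdForm.antidiagonal 3).over L))) : Set ↥(finAdelic (↥(maximalRealSubfield L)) L (IsCMField.complexConj L) 3 ((StdForm.antidiagonal 3).over L))) ∧ Kf ≤ K₀} × {U : ClosedSubrep (((quasiSplit (↥(maximalRealSubfield L)) L (IsCMField.complexConj L) 3).rightRegular μ).restrict ((archToAdelic (↥(maximalRealSubfield L)) L (IsCMField.complexConj L) 3 ((StdForm.antidiagonal 3).over L)).comp (Subgroup.inclusion (inf_le_left : (UnitaryGroup.arch (↥(maximalRealSubfield L)) L (IsCMField.complexConj L) 3 ((StdForm.antidiagonal 3).over L) ⊓ unitaryGroupOfForm (conjMixed (↥(maximalRealSubfield L)) L (IsCMField.complexConj L)) 1) ≤ UnitaryGroup.arch (↥(maximalRealSubfield L)) L (IsCMField.complexConj L) 3 ((StdForm.antidiagonal 3).over L))))) // U.toContRep.IsTopI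rreducible},
      P.toSubmodule ⊓ ((⨅ u : ↥(i.1.1), Module.End.eigenspace ((((quasiSplit (↥(maximalRealSubfield L)) L (IsCMField.complexConj L) 3).rightRegular μ) (finAdelicToAdelic (↥(maximalRealSubfield L)) L (IsCMField.complexConj L) 3 ((StdForm.antidiagonal 3).over L) (u : ↥(finAdelic (↥(maximalRealSubfield L)) L (IsCMField.complexConj L) 3 ((StdForm.antidiagonal 3).over L)))) :
        (quasiSplit (↥(maximalRealSubfield L)) L (IsCMField.complexConj L) 3).L2 μ →L[ℂ] (quasiSplit (↥(maximalRealSubfield L)) L (IsCMField.complexConj L) 3).L2 μ) : (quasiSplit (↥(maximalRealSubfield L)) L (IsCMField.complexConj L) 3).L2 μ →ₗ[ℂ] (quasiSplit (↥(maximalRealSubfield L)) L (IsCMField.complexConj L) 3).L2 μ) 1) ⊓ (((((quasiSplit (↥(maximalRealSubfield L)) L (IsCMField.complexConj L) 3).rightRegular μ).restrict ((archToAdelic (↥(maximalRealSubfield L)) L (IsCMField.complexConj L) 3 ((StdForm.antidiagonal 3).over L)).comp (Subgroup.inclusion (inf_le_left : (UnitaryGroup.arch (↥(maximalRealSubfield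 L)) L (IsCMField.complexConj L) 3 ((StdForm.antidiagonal 3).over L) ⊓ unitaryGroupOfForm (conjMixed (↥(maximalRealSubfield L)) L (IsCMField.complexConj L)) 1) ≤ UnitaryGroup.arch (↥(maximalRealSubfield L)) L (IsCMField.complexConj L) 3 ((StdForm.antidiagonal 3).over L)))))).isotypicComponent i.2.1.toContRep).toSubmodule)).topologicalClosure := by
  simpa only [inf_assoc] using residualG_isotypic_density_kType_three L μ P hP K₀ hK₀

/-- **(D₃) IN F1_qs's `P ⊓ Iso i` ASSOCIATION AT THE K₀ OF RECORD** `ι_f⁻¹(K_M1)`. [cite: BrockerTomDieck1985, III (5.7)] [cite: BorelJacquet1979, §4.1] -/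
theorem residualG_isotypic_density_kType_three_maximalLevel_assoc (P : ClosedSubrep ((quasiSplit (↥(maximalRealSubfield L)) L (IsCMField.complexConj L) 3).rightRegular μ)) (hP : P.toContRep.IsTopIrreducible) :
    P.toSubmodule ≤ (⨆ i : {Kf : Subgroup ↥(finAdelic (↥(maximalRealSubfield L)) L (IsCMField.complexConj L) 3 ((StdForm.antidiagonal 3).over L)) // IsOpen ((Kf : Subgroup ↥(finAdelic (↥(maximalRealSubfield L)) L (IsCMField.complexConj L) 3 ((StdForm.antidiagonal 3).over L))) : Set ↥(finAdelic (↥(maximalRealSubfield L)) L (IsCMField.complexConj L) 3 ((StdForm.antidiagonal 3).over L))) ∧ Kf ≤ ((((standardMaximalCompactGL 3 L).comap (adelicVal (↥(maximalRealSubfield L)) L (IsCMField.complexConj L) 3 ((StdForm.antidiagonal 3).over L)) : Subgroup (quasiSplit (↥(maximalRealSubfield L)) L (IsCMField.complexConj L) 3).Adelic)).comap (finAdelicToAdelic (↥(maximalRealSubfield L)) L (IsCMField.complexConj L) 3 ((StdForm.antidiagonal 3).over L)) : Subgroup ↥(finAdelic (↥(maximalRealSubfield L)) L (IsCMField.complexConj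 L) 3 ((StdForm.antidiagonal 3).over L)))} × {U : ClosedSubrep (((quasiSplit (↥(maximalRealSubfield L)) L (IsCMField.complexConj L) 3).rightRegular μ).restrict ((archToAdelic (↥(maximalRealSubfield L)) L (IsCMField.complexConj L) 3 ((StdForm.antidiagonal 3).over L)).comp (Subgroup.inclusion (inf_le_left : (UnitaryGroup.arch (↥(maximalRealSubfield L)) L (IsCMField.complexConj L) 3 ((StdForm.antidiagonal 3).over L) ⊓ unitaryGroupOfForm (conjMixed (↥(maximalRealSubfield L)) L (IsCMField.complexConj L)) 1) ≤ UnitaryGroup.arch (↥(maximalRealSubfield L)) L (IsCMField.complexConj L) 3 ((StdForm.antidiagonal 3).over L))))) // U.toContRep.IsTopIrreducible},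
      P.toSubmodule ⊓ ((⨅ u : ↥(i.1.1), Module.End.eigenspace ((((quasiSplit (↥(maximalRealSubfield L)) L (IsCMField.complexConj L) 3).rightRegular μ) (finAdelicToAdelic (↥(maximalRealSubfield L)) L (IsCMField.complexConj L) 3 ((StdForm.antidiagonal 3).over L) (u : ↥(finAdelic (↥(maximalRealSubfield L)) L (IsCMField.complexConj L) 3 ((StdForm.antidiagonal 3).over L)))) :
        (quasiSplit (↥(maximalRealSubfield L)) L (IsCMField.complexConj L) 3).L2 μ →L[ℂ] (quasiSplit (↥(maximalRealSubfield L)) L (IsCMField.complexConj L) 3).L2 μ) : (quasiSplit (↥(maximalRealSubfield L)) L (IsCMField.complexConj L) 3).L2 μ →ₗ[ℂ] (quasiSplit (↥(maximalRealSubfield L)) L (IsCMField.complexConj L) 3).L2 μ) 1) ⊓ (((((quasiSplit (↥(maximalRealSubfield L)) L (IsCMField.complexConj L) 3).rightRegular μ).restrict ((archToAdelic (↥(maximalRealSubfield L)) L (IsCMField.complexConj L) 3 ((StdForm.antidiagonal 3).over L)).comp (Subgroup.inclusion (inf_le_left : (UnitaryGroup.arch (↥(maximalRealSubfield L)) L (IsCMField.complexConj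 L) 3 ((StdForm.antidiagonal 3).over L) ⊓ unitaryGroupOfForm (conjMixed (↥(maximalRealSubfield L)) L (IsCMField.complexConj L)) 1) ≤ UnitaryGroup.arch (↥(maximalRealSubfield L)) L (IsCMField.complexConj L) 3 ((StdForm.antidiagonal 3).over L)))))).isotypicComponent i.2.1.toContRep).toSubmodule)).topologicalClosure := by
  simpa only [inf_assoc] using residualG_isotypic_density_kType_three_maximalLevel L μ P hP

end CMThree

end Summit.HodgeConjecture.HodgeConjecture.R90.S8

end
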